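import Mathlib
import Summits.HodgeConjecture.HodgeConjecture.Theorems.SoloBlindKernelChannel

/-!
# ASDegenerate — the Artin–Schreier matrix is a "square root": `Ē₁² = -det Ē₁ · I` in char 5 (solo-blind s139)

Solo-blind programme, `work/s138/regime.md` §3 (AS-DEGENERATE LOCUS) and `work/s139/e13.md`;
claims SB-C1078 and SB-C1087.

Informal setting (nothing geometric is formalised here).  In the char-5 satellite analysis of the
wild tangent hyperplane sections of `X₁₀` at its type-11 vertices the K-antisymmetric digit is
`d_K = d₁(1,0,-1) + d₂(0,1,-1)` and the Artin–Schreier matrix is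
`Ē₁ = [[2d₁+3d₂, 3d₁+d₂],[d₁+3d₂, 3d₁+2d₂]]` (`SoloBlindKernelChannel.det_E1`:
`det Ē₁ = 3 N(d)`, `N(d) = d₁² + d₁d₂ + d₂²`).

This file records, as identities over an arbitrary commutative ring / field:
* `normK_factor`, `normK_eq_zero_iff` : given `ω` with `ω² + ω + 1 = 0`,
  `N(d) = (d₁ - ω d₂)(d₁ - ω² d₂)`, so over a field the AS-degenerate locus `det Ē₁ = 0` is exactly
  the two eigenlines `d₁ = ω d₂`, `d₁ = ω² d₂` (`detE1_eq_zero_iff`, needs `3 ≠ 0`);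
* `traceE1` : `tr Ē₁ = 5 (d₁ + d₂)`, hence `0` in characteristic 5, and the entrywise
  Cayley–Hamilton identities `E1_sq_₀₀ … E1_sq_₁₁` : `Ē₁² = tr Ē₁ · Ē₁ - det Ē₁ · I`;
* consequences in characteristic 5: `Ē₁² = -3 N(d) · I` (`E1_sq_charFive`) — the AS matrix is a
  scalar square root — and on the AS-degenerate locus `Ē₁` is NILPOTENT, `Ē₁² = 0`
  (`E1_sq_eq_zero_of_normK_eq_zero`), which is the algebraic reason the degenerate satellite tower
  needs two scales.
-/

namespace Summit.HodgeConjecture.HodgeConjecture.Theorems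

/-- Factorisation of the norm form of `K` over a ring containing a primitive cube root of unity. -/
theorem normK_factor {R : Type*} [CommRing R] (ω d₁ d₂ : R) (hω : ω^2 + ω + 1 = 0) :
    d₁^2 + d₁*d₂ + d₂^2 = (d₁ - ω*d₂) * (d₁ - ω^2*d₂) := by
  linear_combination (d₁*d₂ - (ω - 1)*d₂^2) * hω

/-- Over a field with a primitive cube root of unity the norm-zero cone is the union of the two
eigenlines `d₁ = ω d₂` and `d₁ = ω² d₂`. -/
theorem normK_eq_zero_iff {F : Type*} [Field F] (ω : F) (hω : ω^2 + ω + 1 = 0) (d₁ d₂ : F) :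
    d₁^2 + d₁*d₂ + d₂^2 = 0 ↔ d₁ = ω*d₂ ∨ d₁ = ω^2*d₂ := by
  rw [normK_factor ω d₁ d₂ hω, mul_eq_zero, sub_eq_zero, sub_eq_zero]

/-- The AS-degenerate locus `det Ē₁ = 0` over a field with `3 ≠ 0` and a primitive cube root of
unity: exactly the two eigenlines. -/
theorem detE1_eq_zero_iff {F : Type*} [Field F] (h3 : (3:F) ≠ 0) (ω : F) (hω : ω^2 + ω + 1 = 0)
    (d₁ d₂ : F) :
    (2*d₁ + 3*d₂) * (3*d₁ + 2*d₂) - (3*d₁ + d₂) * (d₁ + 3*d₂) = 0 ↔ d₁ = ω*d₂ ∨ d₁ = ω^2*d₂ := by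
  rw [det_E1, mul_eq_zero, normK_eq_zero_iff ω hω]
  constructor
  · rintro (h | h)
    · exact absurd h h3
    · exact h
  · intro h; exact Or.inr h

/-- Trace of the AS matrix: `tr Ē₁ = 5 (d₁ + d₂)`. -/
theorem traceE1 {R : Type*} [CommRing R] (d₁ d₂ : R) :
    (2*d₁ + 3*d₂) + (3*d₁ + 2*d₂) = 5*(d₁ + d₂) := by
  ring

/-- In characteristic 5 the AS matrix is traceless. -/
theorem traceE1_charFive {R : Type*} [CommRing R] [CharP R 5] (d₁ d₂ : R) :
    (2*d₁ + 3*d₂) + (3*d₁ + 2*d₂) = 0 := by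
  have h5 : (5:R) = 0 := by simpa using (CharP.cast_eq_zero R 5)
  rw [traceE1, h5, zero_mul]

/-- Cayley–Hamilton, entry `(0,0)`: `(Ē₁²)₀₀ = tr Ē₁ · (Ē₁)₀₀ - det Ē₁`. -/
theorem E1_sq_₀₀ {R : Type*} [CommRing R] (d₁ d₂ : R) :
    (2*d₁ + 3*d₂) * (2*d₁ + 3*d₂) + (3*d₁ + d₂) * (d₁ + 3*d₂)
      = 5*(d₁ + d₂) * (2*d₁ + 3*d₂) - 3 * (d₁^2 + d₁*d₂ + d₂^2) := by
  ring

/-- Cayley–Hamilton, entry `(0,1)`: `(Ē₁²)₀₁ = tr Ē₁ · (Ē₁)₀₁`. -/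
theorem E1_sq_₀₁ {R : Type*} [CommRing R] (d₁ d₂ : R) :
    (2*d₁ + 3*d₂) * (3*d₁ + d₂) + (3*d₁ + d₂) * (3*d₁ + 2*d₂) = 5*(d₁ + d₂) * (3*d₁ + d₂) := by
  ring

/-- Cayley–Hamilton, entry `(1,0)`: `(Ē₁²)₁₀ = tr Ē₁ · (Ē₁)₁₀`. -/
theorem E1_sq_₁₀ {R : Type*} [CommRing R] (d₁ d₂ : R) :
    (d₁ + 3*d₂) * (2*d₁ + 3*d₂) + (3*d₁ + 2*d₂) * (d₁ + 3*d₂) = 5*(d₁ + d₂) * (d₁ + 3*d₂) := by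
  ring

/-- Cayley–Hamilton, entry `(1,1)`: `(Ē₁²)₁₁ = tr Ē₁ · (Ē₁)₁₁ - det Ē₁`. -/
theorem E1_sq_₁₁ {R : Type*} [CommRing R] (d₁ d₂ : R) :
    (d₁ + 3*d₂) * (3*d₁ + d₂) + (3*d₁ + 2*d₂) * (3*d₁ + 2*d₂)
      = 5*(d₁ + d₂) * (3*d₁ + 2*d₂) - 3 * (d₁^2 + d₁*d₂ + d₂^2) := by
  ring

/-- In characteristic 5 the AS matrix is a scalar square root: `Ē₁² = -3 N(d) · I`
(all four entries). -/
theorem E1_sq_charFive {R : Type*} [CommRing R] [CharP R 5] (d₁ d₂ : R) :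
    (2*d₁ + 3*d₂) * (2*d₁ + 3*d₂) + (3*d₁ + d₂) * (d₁ + 3*d₂) = -(3 * (d₁^2 + d₁*d₂ + d₂^2))
    ∧ (2*d₁ + 3*d₂) * (3*d₁ + d₂) + (3*d₁ + d₂) * (3*d₁ + 2*d₂) = 0
    ∧ (d₁ + 3*d₂) * (2*d₁ + 3*d₂) + (3*d₁ + 2*d₂) * (d₁ + 3*d₂) = 0
    ∧ (d₁ + 3*d₂) * (3*d₁ + d₂) + (3*d₁ + 2*d₂) * (3*d₁ + 2*d₂) = -(3 * (d₁^2 + d₁*d₂ + d₂^2)) := by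
  have h5 : (5:R) = 0 := by simpa using (CharP.cast_eq_zero R 5)
  refine ⟨?_, ?_, ?_, ?_⟩
  · rw [E1_sq_₀₀, h5]; ring
  · rw [E1_sq_₀₁, h5]; ring
  · rw [E1_sq_₁₀, h5]; ring
  · rw [E1_sq_₁₁, h5]; ring

/-- On the AS-degenerate locus (norm zero) in characteristic 5 the AS matrix is nilpotent:
`Ē₁² = 0` entrywise. -/
theorem E1_sq_eq_zero_of_normK_eq_zero {R : Type*} [CommRing R] [CharP R 5] (d₁ d₂ : R)
    (h : d₁^2 + d₁*d₂ + d₂^2 = 0) :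
    (2*d₁ + 3*d₂) * (2*d₁ + 3*d₂) + (3*d₁ + d₂) * (d₁ + 3*d₂) = 0
    ∧ (2*d₁ + 3*d₂) * (3*d₁ + d₂) + (3*d₁ + d₂) * (3*d₁ + 2*d₂) = 0
    ∧ (d₁ + 3*d₂) * (2*d₁ + 3*d₂) + (3*d₁ + 2*d₂) * (d₁ + 3*d₂) = 0
    ∧ (d₁ + 3*d₂) * (3*d₁ + d₂) + (3*d₁ + 2*d₂) * (3*d₁ + 2*d₂) = 0 := by
  obtain ⟨h₀₀, h₀₁, h₁₀, h₁₁⟩ := E1_sq_charFive d₁ d₂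
  refine ⟨?_, h₀₁, h₁₀, ?_⟩
  · rw [h₀₀, h]; ring
  · rw [h₁₁, h]; ring

/-- Conversely, over a field of characteristic 5, `Ē₁² = 0` (it suffices to look at the `(0,0)`
entry) forces the norm to vanish: nilpotency characterises the AS-degenerate locus. -/
theorem normK_eq_zero_of_E1_sq_₀₀_eq_zero {F : Type*} [Field F] [CharP F 5] (d₁ d₂ : F)
    (h : (2*d₁ + 3*d₂) * (2*d₁ + 3*d₂) + (3*d₁ + d₂) * (d₁ + 3*d₂) = 0) :
    d₁^2 + d₁*d₂ + d₂^2 = 0 := by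
  have h3 : (3:F) ≠ 0 := by
    intro h3
    have h35 : ((3:ℕ):F) = 0 := by simpa using h3
    have := (CharP.cast_eq_zero_iff F 5 3).mp h35
    omega
  have e := (E1_sq_charFive d₁ d₂).1
  rw [h] at e
  have : 3 * (d₁^2 + d₁*d₂ + d₂^2) = 0 := by linear_combination e
  rcases mul_eq_zero.mp this with h' | h'
  · exact absurd h' h3
  · exact h'

end Summit.HodgeConjecture.HodgeConjecture.Theorems
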